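import Summits.ValiantsHypothesis.ValiantsHypothesis.Theorems.LacunarySymmetroidMatrixDescartesCensusDoorA34SheetDefiniteLetter

/-!
# `MatrixDescartes` census — DOOR A at `(3,4)`: the definite-letter law on the null-top sheet — the ADJUGATE CELL FROM THE LETTER (`S ⪰ 0 ⇒ adj S ⪰ 0`),
# the semidefinite-cell form of the law, and INSTANCES on the census bulk supports and on the `(0,1,4,100)` rail

HONEST FRAMING.  Object-search cell `pub-symmetroid`, engine seat `val-sym-eng-2` (g4); helper rows beside the registered strata line
`Cruxes/DoorA34/Lines/strata.lean` on stmt-ValiantsHypothesis-19980 (`DoorA34 = PosRootLawAt 3 4 18`: OPEN, typed, never asserted here).  Companion of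
…SheetDefiniteLetter (`card_posRoots_le_17_of_definite_lower_letter_sheet`):

* `adjugate_posSemidef_of_posSemidef` (any size: `A = BᴴB ⇒ adj A = adj B·(adj B)ᴴ`), `adjugate_posSemidef_of_semidef_cell` (`3 × 3`: `S ⪰ 0` or `S ⪯ 0`
  ⇒ `adj S ⪰ 0`) — so the SEMIDEFINITE inertia cell of the singular top letter (the cell of the kernel sixteens p619923 / p623646) is the adjugate cell
  `c = 0` of the law: `card_posRoots_le_17_of_definite_lower_letter_semidefCell`;
* instances (`decide`): on the census bulk supports `(0,6,20,29)`, `(0,8,17,29)`, `(0,10,22,38)` a null-top eighteen has THREE INDEFINITE lower letters (both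
  adjugate cells); on the rail support `(0,1,4,100)` (kernel seventeen p584238, semidefinite sixteen p619923): in the semidefinite cell the third letter `S₂` is
  not definite, in the negative adjugate cell (indefinite top letter) `S₀` and `S₁` are not definite.
  Located (this seat, Python, same test): of the 2060 sorted sheet-Sidon supports with `d₃ ≤ 30`, 627 obstruct EVERY definite lower letter in BOTH cells
  (927 in the cell `adj S₃ ⪰ 0`, 1112 in `−adj S₃ ⪰ 0`); obstructed (support, letter) pairs 3919 / 4640 of 6180 per cell.

Nothing here bounds anything on the all-indefinite residue; `DoorA34` and the three stubs stay OPEN; registers unchanged; nothing on `MatrixDescartes`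
(stmt-ValiantsHypothesis-18050) or `VP ≠ VNP` — VP≠VNP not moved.  [folklore] Schur product / `C⋆`-factorisation of PSD matrices / Descartes; elementary.
-/

-- `Summit.ValiantsHypothesis.ValiantsHypothesis.…` repeats a component by the D-0017 layout
-- (single-conjunct summit), which the `dupNamespace` linter flags; the name is mandated.
set_option linter.dupNamespace false

namespace Summit.ValiantsHypothesis.ValiantsHypothesis.Theorems.LacunarySymmetroidMatrixDescartes.Census

open Polynomial Finset Matrix
open scoped BigOperators Polynomial Matrix

/-- **The adjugate of a positive semidefinite matrix is positive semidefinite** (`A = BᴴB ⇒ adj A = adj B · (adj B)ᴴ`; any size). [folklore] -/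
theorem adjugate_posSemidef_of_posSemidef {n : Type*} [Fintype n] [DecidableEq n] {A : Matrix n n ℝ} (hA : A.PosSemidef) :
    A.adjugate.PosSemidef := by
  open scoped MatrixOrder in
  obtain ⟨B, hB⟩ := CStarAlgebra.nonneg_iff_eq_star_mul_self.mp hA.nonneg
  rw [hB, star_eq_conjTranspose, adjugate_mul_distrib, ← adjugate_conjTranspose]
  exact posSemidef_self_mul_conjTranspose _

/-- For `3 × 3` letters `adj(−S) = adj S`, so a NEGATIVE semidefinite letter also has `adj S ⪰ 0`: the SEMIDEFINITE inertia cell of the top letter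
(`S₃ ⪰ 0` or `S₃ ⪯ 0`) lies in the adjugate cell `adj S₃ ⪰ 0` of the law. [folklore] -/
theorem adjugate_posSemidef_of_semidef_cell {S : Matrix (Fin 3) (Fin 3) ℝ} (h : S.PosSemidef ∨ (-S).PosSemidef) : S.adjugate.PosSemidef := by
  rcases h with h | h
  · exact adjugate_posSemidef_of_posSemidef h
  · have hneg : (-S).adjugate = S.adjugate := by
      rw [← neg_one_smul ℝ S, Matrix.adjugate_smul]; simp
    rw [← hneg]; exact adjugate_posSemidef_of_posSemidef h

/-- **The law in the SEMIDEFINITE CELL stated on the letter**: `S₃ ⪰ 0` or `S₃ ⪯ 0` (and `det S₃ = 0`), a definite lower letter, and the failed test with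
`c = 0` ⇒ `≤ 17`. [folklore] -/
theorem card_posRoots_le_17_of_definite_lower_letter_semidefCell (d : Fin 4 → ℕ) (hd : StrictMono d) (S : Fin 4 → Matrix (Fin 3) (Fin 3) ℝ)
    (hS : ∀ l, (S l).IsSymm) (h3 : (S 3).det = 0) (hcell : (S 3).PosSemidef ∨ (-(S 3)).PosSemidef)
    (a : Fin 4) (ha : (S a).PosDef ∨ (-S a).PosDef)
    (ρ : ℕ → ℕ) (hρ : ∀ e, ρ e = ((((Finset.univ : Finset (Sym (Fin 4) 3)).erase (Sym.replicate 3 3)).image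
          (fun s : Sym (Fin 4) 3 => ((s : Multiset (Fin 4)).map d).sum)).filter (· < e)).card)
    (V : Fin 4 → Fin 4 → ℕ)
    (hV : ∀ x y : Fin 4, x ≠ y → V x y = (ρ (3 * d x) + ρ (2 * d x + d y)) % 2
        + (ρ (2 * d x + d y) + ρ (2 * d y + d x)) % 2 + (ρ (2 * d y + d x) + ρ (3 * d y)) % 2)
    (W : Fin 4 → ℕ) (hW : ∀ x : Fin 4, W x = (ρ (3 * d x) + ρ (2 * d x + d 3)) % 2 + (ρ (2 * d x + d 3) + ρ (2 * d 3 + d x)) % 2)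
    (htest : ∀ σ : Fin 4 → SignType, σ a ≠ 0 →
        (∀ x y : Fin 4, x ≠ y → x ≠ 3 → y ≠ 3 → σ x ≠ 0 → σ y ≠ 0 → V x y = if σ x = σ y then 0 else 3) →
        (∀ x y : Fin 4, x ≠ y → x ≠ 3 → y ≠ 3 → σ x ≠ 0 → σ y = 0 → V x y ≠ 0 ∧ V x y ≠ 3) →
        (∀ x : Fin 4, x ≠ 3 → σ x ≠ 0 → W x % 2 = 0) → False) :
    ((Matrix.det (∑ l, ((X : ℝ[X]) ^ d l) • (S l).map C)).roots.toFinset.filter (fun t => 0 < t)).card ≤ 17 :=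
  card_posRoots_le_17_of_definite_lower_letter_sheet d hd S hS h3 0 (Or.inl ⟨adjugate_posSemidef_of_semidef_cell hcell, rfl⟩) a ha ρ hρ V hV W hW htest

/-- The `19` sheet exponents of `(0, 6, 20, 29)`. [folklore] -/
theorem sheetExponents_0_6_20_29 :
    (((Finset.univ : Finset (Sym (Fin 4) 3)).erase (Sym.replicate 3 3)).image
        (fun s : Sym (Fin 4) 3 => ((s : Multiset (Fin 4)).map (![0, 6, 20, 29] : Fin 4 → ℕ)).sum))
      = ({0, 6, 12, 18, 20, 26, 29, 32, 35, 40, 41, 46, 49, 55, 58, 60, 64, 69, 78} : Finset ℕ) := by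
  decide

set_option synthInstance.maxSize 2048 in
set_option synthInstance.maxHeartbeats 400000 in
/-- **`(0, 6, 20, 29)`: a null-top eighteen has three INDEFINITE lower letters** (the census bulk seventeen support `(0,6,20,29)` (exact null-top sixteen by projection, this seat, located); the test fails for every
lower letter in both adjugate cells, `decide`). [folklore] -/
theorem card_posRoots_le_17_of_definite_lower_letter_on_0_6_20_29 (S : Fin 4 → Matrix (Fin 3) (Fin 3) ℝ) (hS : ∀ l, (S l).IsSymm)
    (h3 : (S 3).det = 0) (hcell : (S 3).adjugate.PosSemidef ∨ (-(S 3).adjugate).PosSemidef)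
    (a : Fin 4) (ha3 : a ≠ 3) (ha : (S a).PosDef ∨ (-S a).PosDef) :
    ((Matrix.det (∑ l, ((X : ℝ[X]) ^ ((![0, 6, 20, 29] : Fin 4 → ℕ) l) • (S l).map C))).roots.toFinset.filter (fun t => 0 < t)).card ≤ 17 := by
  have hd : StrictMono (![0, 6, 20, 29] : Fin 4 → ℕ) := by
    refine Fin.strictMono_iff_lt_succ.2 fun j => ?_
    fin_cases j <;> decide
  rcases hcell with hcell | hcell
  · refine card_posRoots_le_17_of_definite_lower_letter_sheet _ hd S hS h3 0 (Or.inl ⟨hcell, rfl⟩) a ha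
      (fun e => ((({0, 6, 12, 18, 20, 26, 29, 32, 35, 40, 41, 46, 49, 55, 58, 60, 64, 69, 78} : Finset ℕ)).filter (· < e)).card)
      (fun e => by rw [sheetExponents_0_6_20_29]) (![![0, 3, 1, 1], ![3, 0, 0, 2], ![1, 0, 0, 2], ![1, 2, 2, 0]]) (by decide) (![0, 1, 1, 0]) (by decide) ?_
    clear ha hcell; revert ha3 a; decide
  · refine card_posRoots_le_17_of_definite_lower_letter_sheet _ hd S hS h3 1 (Or.inr ⟨hcell, rfl⟩) a ha
      (fun e => ((({0, 6, 12, 18, 20, 26, 29, 32, 35, 40, 41, 46, 49, 55, 58, 60, 64, 69, 78} : Finset ℕ)).filter (· < e)).card)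
      (fun e => by rw [sheetExponents_0_6_20_29]) (![![0, 3, 1, 1], ![3, 0, 0, 2], ![1, 0, 0, 2], ![1, 2, 2, 0]]) (by decide) (![0, 1, 1, 0]) (by decide) ?_
    clear ha hcell; revert ha3 a; decide

/-- The `19` sheet exponents of `(0, 8, 17, 29)`. [folklore] -/
theorem sheetExponents_0_8_17_29 :
    (((Finset.univ : Finset (Sym (Fin 4) 3)).erase (Sym.replicate 3 3)).image
        (fun s : Sym (Fin 4) 3 => ((s : Multiset (Fin 4)).map (![0, 8, 17, 29] : Fin 4 → ℕ)).sum))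
      = ({0, 8, 16, 17, 24, 25, 29, 33, 34, 37, 42, 45, 46, 51, 54, 58, 63, 66, 75} : Finset ℕ) := by
  decide

set_option synthInstance.maxSize 2048 in
set_option synthInstance.maxHeartbeats 400000 in
/-- **`(0, 8, 17, 29)`: a null-top eighteen has three INDEFINITE lower letters** (the census bulk seventeen support `(0,8,17,29)`; the test fails for every
lower letter in both adjugate cells, `decide`). [folklore] -/
theorem card_posRoots_le_17_of_definite_lower_letter_on_0_8_17_29 (S : Fin 4 → Matrix (Fin 3) (Fin 3) ℝ) (hS : ∀ l, (S l).IsSymm)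
    (h3 : (S 3).det = 0) (hcell : (S 3).adjugate.PosSemidef ∨ (-(S 3).adjugate).PosSemidef)
    (a : Fin 4) (ha3 : a ≠ 3) (ha : (S a).PosDef ∨ (-S a).PosDef) :
    ((Matrix.det (∑ l, ((X : ℝ[X]) ^ ((![0, 8, 17, 29] : Fin 4 → ℕ) l) • (S l).map C))).roots.toFinset.filter (fun t => 0 < t)).card ≤ 17 := by
  have hd : StrictMono (![0, 8, 17, 29] : Fin 4 → ℕ) := by
    refine Fin.strictMono_iff_lt_succ.2 fun j => ?_
    fin_cases j <;> decide
  rcases hcell with hcell | hcell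
  · refine card_posRoots_le_17_of_definite_lower_letter_sheet _ hd S hS h3 0 (Or.inl ⟨hcell, rfl⟩) a ha
      (fun e => ((({0, 8, 16, 17, 24, 25, 29, 33, 34, 37, 42, 45, 46, 51, 54, 58, 63, 66, 75} : Finset ℕ)).filter (· < e)).card)
      (fun e => by rw [sheetExponents_0_8_17_29]) (![![0, 2, 3, 1], ![2, 0, 3, 1], ![3, 3, 0, 2], ![1, 1, 2, 0]]) (by decide) (![1, 1, 1, 0]) (by decide) ?_
    clear ha hcell; revert ha3 a; decide
  · refine card_posRoots_le_17_of_definite_lower_letter_sheet _ hd S hS h3 1 (Or.inr ⟨hcell, rfl⟩) a ha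
      (fun e => ((({0, 8, 16, 17, 24, 25, 29, 33, 34, 37, 42, 45, 46, 51, 54, 58, 63, 66, 75} : Finset ℕ)).filter (· < e)).card)
      (fun e => by rw [sheetExponents_0_8_17_29]) (![![0, 2, 3, 1], ![2, 0, 3, 1], ![3, 3, 0, 2], ![1, 1, 2, 0]]) (by decide) (![1, 1, 1, 0]) (by decide) ?_
    clear ha hcell; revert ha3 a; decide

/-- The `19` sheet exponents of `(0, 10, 22, 38)`. [folklore] -/
theorem sheetExponents_0_10_22_38 :
    (((Finset.univ : Finset (Sym (Fin 4) 3)).erase (Sym.replicate 3 3)).image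
        (fun s : Sym (Fin 4) 3 => ((s : Multiset (Fin 4)).map (![0, 10, 22, 38] : Fin 4 → ℕ)).sum))
      = ({0, 10, 20, 22, 30, 32, 38, 42, 44, 48, 54, 58, 60, 66, 70, 76, 82, 86, 98} : Finset ℕ) := by
  decide

set_option synthInstance.maxSize 2048 in
set_option synthInstance.maxHeartbeats 400000 in
/-- **`(0, 10, 22, 38)`: a null-top eighteen has three INDEFINITE lower letters** (the census bulk seventeen support `(0,10,22,38)`; the test fails for every
lower letter in both adjugate cells, `decide`). [folklore] -/
theorem card_posRoots_le_17_of_definite_lower_letter_on_0_10_22_38 (S : Fin 4 → Matrix (Fin 3) (Fin 3) ℝ) (hS : ∀ l, (S l).IsSymm)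
    (h3 : (S 3).det = 0) (hcell : (S 3).adjugate.PosSemidef ∨ (-(S 3).adjugate).PosSemidef)
    (a : Fin 4) (ha3 : a ≠ 3) (ha : (S a).PosDef ∨ (-S a).PosDef) :
    ((Matrix.det (∑ l, ((X : ℝ[X]) ^ ((![0, 10, 22, 38] : Fin 4 → ℕ) l) • (S l).map C))).roots.toFinset.filter (fun t => 0 < t)).card ≤ 17 := by
  have hd : StrictMono (![0, 10, 22, 38] : Fin 4 → ℕ) := by
    refine Fin.strictMono_iff_lt_succ.2 fun j => ?_
    fin_cases j <;> decide
  rcases hcell with hcell | hcell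
  · refine card_posRoots_le_17_of_definite_lower_letter_sheet _ hd S hS h3 0 (Or.inl ⟨hcell, rfl⟩) a ha
      (fun e => ((({0, 10, 20, 22, 30, 32, 38, 42, 44, 48, 54, 58, 60, 66, 70, 76, 82, 86, 98} : Finset ℕ)).filter (· < e)).card)
      (fun e => by rw [sheetExponents_0_10_22_38]) (![![0, 2, 3, 1], ![2, 0, 3, 1], ![3, 3, 0, 2], ![1, 1, 2, 0]]) (by decide) (![1, 1, 1, 0]) (by decide) ?_
    clear ha hcell; revert ha3 a; decide
  · refine card_posRoots_le_17_of_definite_lower_letter_sheet _ hd S hS h3 1 (Or.inr ⟨hcell, rfl⟩) a ha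
      (fun e => ((({0, 10, 20, 22, 30, 32, 38, 42, 44, 48, 54, 58, 60, 66, 70, 76, 82, 86, 98} : Finset ℕ)).filter (· < e)).card)
      (fun e => by rw [sheetExponents_0_10_22_38]) (![![0, 2, 3, 1], ![2, 0, 3, 1], ![3, 3, 0, 2], ![1, 1, 2, 0]]) (by decide) (![1, 1, 1, 0]) (by decide) ?_
    clear ha hcell; revert ha3 a; decide

/-- The `19` sheet exponents of `(0,1,4,100)`. [folklore] -/
theorem sheetExponents_0_1_4_100 :
    (((Finset.univ : Finset (Sym (Fin 4) 3)).erase (Sym.replicate 3 3)).image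
        (fun s : Sym (Fin 4) 3 => ((s : Multiset (Fin 4)).map (![0, 1, 4, 100] : Fin 4 → ℕ)).sum))
      = ({0, 1, 2, 3, 4, 5, 6, 8, 9, 12, 100, 101, 102, 104, 105, 108, 200, 201, 204} : Finset ℕ) := by
  decide

set_option synthInstance.maxSize 2048 in
set_option synthInstance.maxHeartbeats 400000 in
/-- **`(0,1,4,100)` (the support of the kernel's null-top seventeen p584238 and semidefinite sixteen p619923), semidefinite adjugate cell:
the THIRD letter `S₂` of a null-top eighteen is NOT definite** (the test leaves only `S₀, S₁` definite of opposite signs). [folklore] -/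
theorem card_posRoots_le_17_of_definite_third_letter_on_0_1_4_100_semidef (S : Fin 4 → Matrix (Fin 3) (Fin 3) ℝ) (hS : ∀ l, (S l).IsSymm)
    (h3 : (S 3).det = 0) (hcell : (S 3).adjugate.PosSemidef) (ha : (S 2).PosDef ∨ (-S 2).PosDef) :
    ((Matrix.det (∑ l, ((X : ℝ[X]) ^ ((![0, 1, 4, 100] : Fin 4 → ℕ) l) • (S l).map C))).roots.toFinset.filter (fun t => 0 < t)).card ≤ 17 := by
  have hd : StrictMono (![0, 1, 4, 100] : Fin 4 → ℕ) := by
    refine Fin.strictMono_iff_lt_succ.2 fun j => ?_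
    fin_cases j <;> decide
  refine card_posRoots_le_17_of_definite_lower_letter_sheet _ hd S hS h3 0 (Or.inl ⟨hcell, rfl⟩) 2 ha
    (fun e => ((({0, 1, 2, 3, 4, 5, 6, 8, 9, 12, 100, 101, 102, 104, 105, 108, 200, 201, 204} : Finset ℕ)).filter (· < e)).card)
    (fun e => by rw [sheetExponents_0_1_4_100]) (![![0, 3, 1, 1], ![3, 0, 2, 2], ![1, 2, 0, 2], ![1, 2, 2, 0]]) (by decide) (![0, 2, 1, 0]) (by decide) ?_
  decide

set_option synthInstance.maxSize 2048 in
set_option synthInstance.maxHeartbeats 400000 in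
/-- **`(0,1,4,100)`, NEGATIVE adjugate cell (indefinite rank-two top letter — the cell of the kernel seventeens): the letters `S₀` and `S₁` of a
null-top eighteen are NOT definite** (the test leaves only `S₂` definite). [folklore] -/
theorem card_posRoots_le_17_of_definite_low_letter_on_0_1_4_100_indef (S : Fin 4 → Matrix (Fin 3) (Fin 3) ℝ) (hS : ∀ l, (S l).IsSymm)
    (h3 : (S 3).det = 0) (hcell : (-(S 3).adjugate).PosSemidef) (a : Fin 4) (ha01 : a = 0 ∨ a = 1)
    (ha : (S a).PosDef ∨ (-S a).PosDef) :
    ((Matrix.det (∑ l, ((X : ℝ[X]) ^ ((![0, 1, 4, 100] : Fin 4 → ℕ) l) • (S l).map C))).roots.toFinset.filter (fun t => 0 < t)).card ≤ 17 := by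
  have hd : StrictMono (![0, 1, 4, 100] : Fin 4 → ℕ) := by
    refine Fin.strictMono_iff_lt_succ.2 fun j => ?_
    fin_cases j <;> decide
  refine card_posRoots_le_17_of_definite_lower_letter_sheet _ hd S hS h3 1 (Or.inr ⟨hcell, rfl⟩) a ha
    (fun e => ((({0, 1, 2, 3, 4, 5, 6, 8, 9, 12, 100, 101, 102, 104, 105, 108, 200, 201, 204} : Finset ℕ)).filter (· < e)).card)
    (fun e => by rw [sheetExponents_0_1_4_100]) (![![0, 3, 1, 1], ![3, 0, 2, 2], ![1, 2, 0, 2], ![1, 2, 2, 0]]) (by decide) (![0, 2, 1, 0]) (by decide) ?_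
  clear ha hcell; revert ha01 a; decide


end Summit.ValiantsHypothesis.ValiantsHypothesis.Theorems.LacunarySymmetroidMatrixDescartes.Census
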